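import Summits.Ventures.PackingBounds.Energy.NewtonCertificateCorrected
import Summits.Ventures.PackingBounds.Energy.NewtonCertificateDeficit

/-!
# Corrected Newton-form certificates: the deficit inequality (equality case for the 600-cell shape)

Framing: lottery ticket; floor = certified bounds/negative ranges. Venture `PackingBounds` (cell
`pub-packcert`, seat `pub-packcert-energy`), universal-optimality infrastructure: the common refinement of
`NewtonCert.energy_ge_corrected` (corrected partial products `P_j = ω_j - F π_j`, the 600-cell shape) and
`NewtonCert.energy_deficit` (the plain shape with the remainder kept). Under the hypotheses of
`energy_ge_corrected` and `k ≥ D`, every `N`-point configuration satisfies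
`N Σ_i m_i v_i^k + Σ_{x ≠ y} (1+⟨x,y⟩)^{k-D} ω_D(1+⟨x,y⟩) ≤ Σ_{x ≠ y} (1+⟨x,y⟩)^k`
(`energy_deficit_corrected`): a ground state has all inner products at zeros of `ω_D`.

## References
* H. Cohn, A. Kumar, *Universally optimal distribution of points on spheres*, J. Amer. Math. Soc.
  20 (2007) 99–148, Thm. 1.2 and §7. [`CohnKumar2006`]
-/

noncomputable section

namespace Summit.Ventures.PackingBounds.Energy

open Finset Literature.Analysis.SpecialFunctions Literature.Geometry.DiscreteGeometry

namespace NewtonCert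

open scoped Classical in
/-- **Deficit inequality for corrected Newton-form certificates** (hypotheses of
`NewtonCert.energy_ge_corrected`, and `k ≥ D`): the `(1+t)^k`-energy exceeds the certified bound by at least
`Σ_{x ≠ y} (1+⟨x,y⟩)^{k-D} ω_D(1+⟨x,y⟩) ≥ 0`. [cite: CohnKumar2006, Theorem 1.2 and §7] -/
theorem energy_deficit_corrected {n : ℕ} {μ : ℝ} (hn : (n : ℝ) = 2 * μ + 2) (hμ : 0 < μ)
    (D : ℕ) (hD : 1 ≤ D) (v : ℕ → ℝ) (hv : ∀ i, 0 ≤ v i)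
    (hωD : ∀ u : ℝ, 0 ≤ u → 0 ≤ ∏ i ∈ range D, (u - v i))
    (D₀ : ℕ) (hD₀ : D₀ ≤ D) (F : ℝ → ℝ) (hF : ∀ t, 0 ≤ F t)
    (hFω : ∀ t, F t = ∏ i ∈ range D₀, (1 + t - v i))
    (π : ℕ → ℝ → ℝ) (hπ : ∀ j < D, ∀ t : ℝ, -1 ≤ t → t ≤ 1 → 0 ≤ π j t)
    (G : ℕ → ℕ → ℝ) (hG : ∀ j i, 0 ≤ G j i)
    (hcorr : ∀ j < D, ∀ t : ℝ, ∏ i ∈ range j, (1 + t - v i) =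
      ∑ i ∈ range D, G j i * gegenbauerSum μ i t + F t * π j t)
    (N M : ℕ) (hM : M ≤ D₀) (mult : ℕ → ℝ)
    (hdesign : ∀ j < D, (N : ℝ) * G j 0 = ∑ i ∈ range D, G j i * gegenbauerSum μ i 1 +
      ∑ i ∈ range M, mult i * ∏ i' ∈ range j, (v i - v i'))
    (k : ℕ) (hk : D ≤ k) (C : Finset (EuclideanSpace ℝ (Fin n))) (h1 : ∀ x ∈ C, ‖x‖ = 1)
    (hN : C.card = N) :
    (N : ℝ) * ∑ i ∈ range M, mult i * v i ^ k +
        ∑ x ∈ C, ∑ y ∈ C.erase x,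
          (1 + inner ℝ x y) ^ (k - D) * ∏ i ∈ range D, (1 + inner ℝ x y - v i) ≤
      ∑ x ∈ C, ∑ y ∈ C.erase x, (1 + inner ℝ x y) ^ k := by
  obtain ⟨c, r, hc, hr, hexp, -, -, hrem⟩ := newton_exists_strict v hv D hD k
  set α : ℕ → ℝ := fun i => ∑ j ∈ range D, c j * G j i with hαdef
  have hα : ∀ i, 0 ≤ α i := fun i =>
    Finset.sum_nonneg fun j _ => mul_nonneg (hc j) (hG j i)
  -- `Σ_i α_i C_i(t) = Σ_j c_j P_j(t)`
  have hswap : ∀ t : ℝ, ∑ i ∈ range D, α i * gegenbauerSum μ i t =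
      ∑ j ∈ range D, c j * ∑ i ∈ range D, G j i * gegenbauerSum μ i t := by
    intro t
    calc ∑ i ∈ range D, α i * gegenbauerSum μ i t
          = ∑ i ∈ range D, ∑ j ∈ range D, c j * G j i * gegenbauerSum μ i t := by
            refine Finset.sum_congr rfl fun i _ => ?_
            rw [hαdef, Finset.sum_mul]
      _ = ∑ j ∈ range D, ∑ i ∈ range D, c j * G j i * gegenbauerSum μ i t :=
            Finset.sum_comm
      _ = ∑ j ∈ range D, c j * ∑ i ∈ range D, G j i * gegenbauerSum μ i t := by
            refine Finset.sum_congr rfl fun j _ => ?_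
            rw [Finset.mul_sum]
            exact Finset.sum_congr rfl fun i _ => by ring
  -- `P_j(t) = ω_j(1+t) - F(t) π_j(t)`
  have hP : ∀ j ∈ range D, ∀ t : ℝ, ∑ i ∈ range D, G j i * gegenbauerSum μ i t =
      ∏ i ∈ range j, (1 + t - v i) - F t * π j t := fun j hj t => by
    rw [hcorr j (Finset.mem_range.1 hj) t]; ring
  have hD' : D - 1 + 1 = D := Nat.sub_add_cancel hD
  -- the certificate `h_k(t) = Σ_j c_j P_j(t)`; the LP bound applied to `h_k` itself
  set h : ℝ → ℝ := fun t => ∑ j ∈ range D, c j * ∑ i ∈ range D, G j i * gegenbauerSum μ i t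
    with hhdef
  have hH : ∀ t : ℝ, -1 ≤ t → t < 1 →
      ∑ i ∈ range (D - 1 + 1), α i * gegenbauerSum μ i t ≤ h t := by
    intro t _ _
    rw [hD', hswap t]
  have key := EnergyLP.energy_ge_inner hn hμ (D - 1) α hα h hH C h1
  have hα0 : α 0 = ∑ j ∈ range D, c j * G j 0 := by rw [hαdef]
  rw [hD', hN, hswap 1, hα0] at key
  -- evaluate the bound `N² α_0 - N h(1) = N Σ m_i v_i^k`
  have hval : ∀ j ∈ range D, (N : ℝ) * G j 0 - ∑ i ∈ range D, G j i * gegenbauerSum μ i 1 =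
      ∑ i ∈ range M, mult i * ∏ i' ∈ range j, (v i - v i') := fun j hj => by
    rw [hdesign j (Finset.mem_range.1 hj)]; ring
  have hFnode : ∀ i ∈ range M, F (v i - 1) = 0 := fun i hi => by
    rw [hFω]
    have h := omega_node v (lt_of_lt_of_le (Finset.mem_range.1 hi) hM) (D := D₀)
    rw [← h]
    exact Finset.prod_congr rfl fun i' _ => by ring
  have hnode : ∀ i ∈ range M, ∑ j ∈ range D, c j * ∑ i' ∈ range D, G j i' *
      gegenbauerSum μ i' (v i - 1) = v i ^ k := by
    intro i hi
    have h := hexp (v i)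
    rw [omega_node v (lt_of_lt_of_le (Finset.mem_range.1 hi) (hM.trans hD₀)), mul_zero,
      add_zero] at h
    rw [h]
    refine Finset.sum_congr rfl fun j hj => ?_
    rw [hP j hj, hFnode i hi, zero_mul, sub_zero]
    congr 1
    exact Finset.prod_congr rfl fun i' _ => by ring
  have hbound : (N : ℝ) * ∑ i ∈ range M, mult i * v i ^ k =
      (N : ℝ) ^ 2 * ∑ j ∈ range D, c j * G j 0 -
        (N : ℝ) * ∑ j ∈ range D, c j * ∑ i ∈ range D, G j i * gegenbauerSum μ i 1 := by
    calc (N : ℝ) * ∑ i ∈ range M, mult i * v i ^ k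
          = (N : ℝ) * ∑ i ∈ range M, mult i *
              ∑ j ∈ range D, c j * ∏ i' ∈ range j, (v i - v i') := by
            congr 1
            refine Finset.sum_congr rfl fun i hi => ?_
            rw [← hnode i hi]
            congr 1
            refine Finset.sum_congr rfl fun j hj => ?_
            rw [hP j hj, hFnode i hi, zero_mul, sub_zero]
            congr 1
            exact Finset.prod_congr rfl fun i' _ => by ring
      _ = (N : ℝ) * ∑ j ∈ range D, c j *
              ∑ i ∈ range M, mult i * ∏ i' ∈ range j, (v i - v i') := by
            congr 1
            rw [Finset.sum_congr rfl fun i _ => Finset.mul_sum (range D) _ (mult i), Finset.sum_comm]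
            refine Finset.sum_congr rfl fun j _ => ?_
            rw [Finset.mul_sum]
            exact Finset.sum_congr rfl fun i _ => by ring
      _ = (N : ℝ) * ∑ j ∈ range D, c j *
              ((N : ℝ) * G j 0 - ∑ i ∈ range D, G j i * gegenbauerSum μ i 1) := by
            congr 1; exact Finset.sum_congr rfl fun j hj => by rw [hval j hj]
      _ = (N : ℝ) ^ 2 * ∑ j ∈ range D, c j * G j 0 -
            (N : ℝ) * ∑ j ∈ range D, c j * ∑ i ∈ range D, G j i * gegenbauerSum μ i 1 := by
            rw [Finset.mul_sum, Finset.mul_sum, Finset.mul_sum, ← Finset.sum_sub_distrib]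
            exact Finset.sum_congr rfl fun j _ => by ring
  -- termwise: `(1+t)^k = Σ_j c_j ω_j(u) + r(u) ω_D(u) ≥ h(t) + u^{k-D} ω_D(u)` on `[-1, 1]`
  have hterm : ∀ x ∈ C, ∀ y ∈ C.erase x,
      h (inner ℝ x y) + (1 + inner ℝ x y) ^ (k - D) * ∏ i ∈ range D, (1 + inner ℝ x y - v i) ≤
        (1 + inner ℝ x y) ^ k := by
    intro x hx y hy
    have hb := inner_mem_Ico_of_norm_eq_one (h1 x hx) (h1 y (Finset.mem_of_mem_erase hy))
      (Finset.ne_of_mem_erase hy).symm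
    set t := inner ℝ x y with ht
    have hu : (0 : ℝ) ≤ 1 + t := by linarith [hb.1]
    have hωu : 0 ≤ ∏ i ∈ range D, (1 + t - v i) := hωD _ hu
    -- `h(t) ≤ Σ_j c_j ω_j(1+t)`
    have hle : h t ≤ ∑ j ∈ range D, c j * ∏ i ∈ range j, (1 + t - v i) := by
      rw [hhdef]
      refine Finset.sum_le_sum fun j hj => ?_
      rw [hP j hj t]
      have h0 : 0 ≤ c j * (F t * π j t) :=
        mul_nonneg (hc j) (mul_nonneg (hF t) (hπ j (Finset.mem_range.1 hj) t hb.1 hb.2.le))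
      nlinarith [h0]
    have hx' := hexp (1 + t)
    have hr' : (1 + t) ^ (k - D) * ∏ i ∈ range D, (1 + t - v i) ≤
        r (1 + t) * ∏ i ∈ range D, (1 + t - v i) :=
      mul_le_mul_of_nonneg_right (hrem hk _ hu) hωu
    linarith
  have hsum_le : ∑ x ∈ C, ∑ y ∈ C.erase x, h (inner ℝ x y) +
      ∑ x ∈ C, ∑ y ∈ C.erase x,
        (1 + inner ℝ x y) ^ (k - D) * ∏ i ∈ range D, (1 + inner ℝ x y - v i) ≤
      ∑ x ∈ C, ∑ y ∈ C.erase x, (1 + inner ℝ x y) ^ k := by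
    rw [← Finset.sum_add_distrib]
    refine Finset.sum_le_sum fun x hx => ?_
    rw [← Finset.sum_add_distrib]
    exact Finset.sum_le_sum fun y hy => hterm x hx y hy
  rw [hbound]
  linarith

end NewtonCert

end Summit.Ventures.PackingBounds.Energy

end
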